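import Summits.BirchSwinnertonDyer.BirchSwinnertonDyer.Theorems.BiquadraticEisensteinDescentHeegnerTwistCouplingInSupplySylvesterTwistRank
import Summits.BirchSwinnertonDyer.BirchSwinnertonDyer.Theorems.BiquadraticEisensteinDescentHeegnerTwistCouplingInSupplySylvesterCornerSqrtMinusTwo
import Literature.NumberTheory.EllipticCurves.LFunctionSmulProofs
import Literature.NumberTheory.QuadraticFields.FundamentalDiscriminant
import HarnessLib

set_option linter.dupNamespace false -- `Summit.BirchSwinnertonDyer.BirchSwinnertonDyer.Theorems.…` (summit = sub, D-0017)
set_option autoImplicit false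

/-!
# Crux `HeegnerTwistCouplingInSupply` (stmt-BirchSwinnertonDyer-21381) — programme «TWISTED 3-ISOGENY DESCENT», file P7c-D:
# the SYLVESTER corner with `K′ = ℚ(√−2)` from the two decidable certificates, modulo Burungale–Tian ONLY (no `hDescU`)

Route `BiquadraticEisensteinDescent` (cell `pub/bsd-wall`, width seat `bsd-wall-cm-bed-w4` g33; `--supports` 21381, helper). File
`…SylvesterCornerSqrtMinusTwo` (w4 g31) proved the conclusion of crux 21381 at `(W_p, p)`, `W_p : y² + py = x³`, for every prime
`p ≡ 17, 35 (mod 72)` with `X³ − 3X − 10` irreducible mod `p`, MODULO the unformalised `3`-descent hypothesis `hDescU` and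
Burungale–Tian. The programme «TWISTED 3-ISOGENY DESCENT» (files P1–P7c) has now carried out that descent in the tree for
`E : y² = x³ − 2p² ≅ W_p^{(−8)}` under the two decidable certificates

  (h1) `X³ − 3X − 10` has no root in `𝔽_p` (⟺ the unit `5 + 2√6` is not a cube modulo the inert `p`, Lucas/cubic bridges of g26/g31),
  (h2) `p = a² + 2b²` with `9 ∤ a`

((h1) ⟺ (h2) is an Artin-reciprocity law not in the tree; numerically they agree for all 190 primes `≡ 17, 35 (72)` below `2·10⁴`). So here:

* §1 `variableChange_twist` (`W_p^{(−8)} = (y² = x³ − 128p²) ≅_{u=2} (y² = x³ − 2p²)`), `exists_model_sqrt_six` / `exists_model_sqrt_neg_two`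
  (models `F ∋ ω`, `ω² = 6`, and `K ∋ θ`, `θ² = −2`, with their non-trivial automorphisms, from `exists_numberField_discr_eq` + `TauData`);
* §2 ★★★ `entireLFunction_twist_one_ne_zero` — **`L(W_p^{(−8)}, 1) ≠ 0`** for every prime `p ≡ 17, 35 (mod 72)` with (h1) and (h2),
  MODULO Burungale–Tian ONLY (`rank = 0`: P7c-C2; `Ш[3] = 0`: P7c-A2; door `L_one_ne_zero_of_desc_BT`; `L` is an isomorphism invariant);
* §3 ★★★ `cruxConclusion_sqrtMinusTwo_of_certificates` / `cruxOnSylvesterCorner_of_certificates` / the crux BODY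
  `heegnerTwistCouplingInSupply_sylvester_of_certificates` — the conclusion of `HeegnerTwistCouplingInSupply` at `(W_p, p)` with
  `K′ = ℚ(√−2)`, MODULO Burungale–Tian ONLY; §4 kernel instances `p = 17` (`17 = 3² + 2·2²`) and `p = 107` (`107 = 3² + 2·7²`).

HONEST FRAMING: a measure-zero corner of the crux (one CM family, certified primes), now conditional ONLY on the named fact
`burungaleTian_analyticRank_eq_zero_of_selmerCorank_eq_zero_of_hasCM`; the infinitude of certified primes (Chebotarev), the law
(h1) ⟺ (h2), the crux (residual C⁺) for general `W`, its registered stubs and BSD are untouched. THEOREMS ONLY (no `def`, no named fact,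
no sorry). Supports stmt-BirchSwinnertonDyer-21381.
[cite: CohenPazuki2009, §2] [cite: BurungaleTian2026, Thm. 1.1] [cite: SilvermanAEC2009, X.5 Prop. 5.4; App. C §16] [cite: IrelandRosen1990, §9.1]
-/

noncomputable section

open scoped Classical NumberField

namespace Summit.BirchSwinnertonDyer.BirchSwinnertonDyer.Theorems.SylvesterTwistDescent

open Literature.NumberTheory.EllipticCurves Literature.NumberTheory.EllipticCurves.MordellDescent
open Literature.NumberTheory.EllipticCurves.Rank1Residual Literature.NumberTheory.QuadraticFields
open Literature.NumberTheory.QuadraticFields.Quadratic NumberField WeierstrassCurve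
open Summit.BirchSwinnertonDyer.BirchSwinnertonDyer.Theorems.SylvesterCorner

/-! ## §1 The model `y² = x³ − 2p²` of `W_p^{(−8)}` and models of `ℚ(√6)`, `ℚ(√−2)` -/

/-- **`W_p^{(−8)} ≅ (y² = x³ − 2p²)`**: `(y² + py = x³)^{(−8)} = (y² = x³ − 128p²)` and the change of variables `u = 2` gives
`y² = x³ − 2p²`. [cite: SilvermanAEC2009, X.5 Prop. 5.4] -/
theorem variableChange_twist (p : ℕ) :
    (⟨Units.mk0 (2 : ℚ) two_ne_zero, 0, 0, 0⟩ : VariableChange ℚ) •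
        (⟨0, 0, (p : ℚ), 0, 0⟩ : WeierstrassCurve ℚ).quadraticTwist (((-8 : ℤ)) : ℚ) = mordellCurve (-2 * (p : ℚ) ^ 2) := by
  rw [quadraticTwist_sylvester]
  ext
  · simp [mordellCurve, variableChange_a₁]
  · simp [mordellCurve, variableChange_a₂]
  · simp [mordellCurve, variableChange_a₃]
  · simp [mordellCurve, variableChange_a₄]
  · simp [mordellCurve, variableChange_a₆]
    ring

/-- A Bhargava basis of a quadratic field of discriminant `4m` (`m ≡ 2, 3 (mod 4)`) has `τ² = m`. [cite: Marcus2018, Ch. 2 Thm. 1] -/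
theorem TauData.coe_sq_eq {L : Type} [Field L] [NumberField L] (T : TauData L) {m : ℤ} (hd : NumberField.discr L = 4 * m) :
    ((T.τ : 𝓞 L) : L) ^ 2 = (m : L) := by
  have hdisc := T.discr_eq
  have hεm : T.ε = 0 ∧ T.m = m := by rcases T.ε_eq with h | h <;> omega
  have h := congrArg (algebraMap (𝓞 L) L) T.τ_sq
  rw [map_mul, map_add, map_mul, map_intCast, map_intCast, hεm.1, hεm.2] at h
  rw [sq, RingOfIntegers.coe_eq_algebraMap, h]; push_cast; ring

/-- **A model of `ℚ(√6)`** with its conjugation: `[F:ℚ] = 2`, `ω² = 6`, `c ≠ 1`. [cite: Marcus2018, Ch. 2 Thm. 1] -/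
theorem exists_model_sqrt_six : ∃ (F : Type) (_ : Field F) (_ : NumberField F) (ω : F) (c : F ≃ₐ[ℚ] F),
    Module.finrank ℚ F = 2 ∧ ω ^ 2 = 6 ∧ c ≠ 1 := by
  have hsf : Squarefree (6 : ℤ) := by
    rw [← Int.squarefree_natAbs, show Int.natAbs 6 = 2 * 3 by norm_num, Nat.squarefree_mul (by norm_num)]
    exact ⟨Nat.prime_two.prime.squarefree, Nat.prime_three.prime.squarefree⟩
  obtain ⟨F, iF, iN, hF2, hdF⟩ := exists_numberField_discr_eq (D := 24)
    (Or.inr ⟨by norm_num, Or.inl (by norm_num), by norm_num; exact hsf⟩)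
  obtain ⟨T⟩ := nonempty_tauData (K := F) hF2
  obtain ⟨c, hc⟩ := SqrtNegTwoIntegers.exists_algEquiv_ne_one hF2
  exact ⟨F, iF, iN, (T.τ : F), c, hF2, by rw [TauData.coe_sq_eq T (m := 6) (by rw [hdF]; norm_num)]; norm_num, hc⟩

/-- **A model of `ℚ(√−2)`** with its conjugation: `K ∋ θ`, `θ² = −2` (`SqrtNegTwo.FieldData`), `c ≠ 1`. [cite: Marcus2018, Ch. 2 Thm. 1] -/
theorem exists_model_sqrt_neg_two : ∃ (K : Type) (_ : Field K) (_ : NumberField K) (θ : K) (c : K ≃ₐ[ℚ] K),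
    SqrtNegTwo.FieldData θ ∧ c ≠ 1 := by
  have hsf : Squarefree (-2 : ℤ) := Int.prime_two.neg.squarefree
  obtain ⟨K, iK, iN, hK2, hdK⟩ := exists_numberField_discr_eq (D := -8)
    (Or.inr ⟨by norm_num, Or.inl (by norm_num), by norm_num; exact hsf⟩)
  obtain ⟨T⟩ := nonempty_tauData (K := K) hK2
  obtain ⟨c, hc⟩ := SqrtNegTwoIntegers.exists_algEquiv_ne_one hK2
  exact ⟨K, iK, iN, (T.τ : K), c, ⟨hK2, by rw [TauData.coe_sq_eq T (m := -2) (by rw [hdK]; norm_num)]; norm_num⟩, hc⟩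

/-! ## §2 `L(W_p^{(−8)}, 1) ≠ 0` from the certificates -/

/-- ★★★ **`L(W_p^{(−8)}, 1) ≠ 0` for every prime `p ≡ 17, 35 (mod 72)` with (h1) `X³ − 3X − 10` irreducible mod `p` and (h2) `p = a² + 2b²`,
`9 ∤ a`, MODULO Burungale–Tian ONLY.** The descent (P7c-C2: `rank = 0`; P7c-A2: `Ш[3] = 0`) on `y² = x³ − 2p²` under the unit form
of (h1) (Lucas bridge `exists_unit_not_cube_of_lucas` + cubic bridge `lucas_of_forall_cubic_ne_zero`, `d = 24`, `(a, b) = (10, 2)`),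
the door `L_one_ne_zero_of_desc_BT` at `j = 0`, and isomorphism invariance of `L` (`entireLFunction_smul`).
[cite: CohenPazuki2009, §2] [cite: BurungaleTian2026, Thm. 1.1] [cite: SilvermanAEC2009, App. C §16] -/
theorem entireLFunction_twist_one_ne_zero (hBT : burungaleTian_analyticRank_eq_zero_of_selmerCorank_eq_zero_of_hasCM)
    {p : ℕ} (hp : p.Prime) (hp72 : p % 72 = 17 ∨ p % 72 = 35) (h1 : ∀ x : ZMod p, x ^ 3 - 3 * x - 10 ≠ 0)
    {a b : ℤ} (hab : a ^ 2 + 2 * b ^ 2 = p) (h9 : ¬ (9 : ℤ) ∣ a) :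
    ((⟨0, 0, (p : ℚ), 0, 0⟩ : WeierstrassCurve ℚ).quadraticTwist (((-8 : ℤ)) : ℚ)).entireLFunction 1 ≠ 0 := by
  obtain ⟨hp9, hp8⟩ := (mod_seventyTwo_iff p).mp hp72
  have hp2 : p ≠ 2 := by rintro rfl; omega
  have hp3 : p % 3 = 2 := by omega
  -- models of the two Kummer fields
  obtain ⟨F, iF, iNF, ω, cF, hF2, hω, hcF⟩ := exists_model_sqrt_six
  obtain ⟨K, iK, iNK, θ, cK, hK, hcK⟩ := exists_model_sqrt_neg_two
  -- (h1) in unit form: the unit `5 + 2√6 = (10 + 2√24)/2` is not a cube modulo `p`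
  have hJ8 : jacobiSym (-8) p = 1 := jacobiSym_neg_eight_eq_one hp8
  have hJ24 : jacobiSym 24 p = -1 := by
    rw [show (24 : ℤ) = -3 * -8 by norm_num, jacobiSym.mul_left, jacobiSym_neg_three_eq_neg_one (hp.odd_of_ne_two hp2) hp3, hJ8]
    norm_num
  have hLuc := lucas_of_forall_cubic_ne_zero hp hp2 hp3 hJ24 (a := 10) (b := 2) (by norm_num) (fun x => by push_cast; exact h1 x)
  obtain ⟨u₀, hu₀⟩ := exists_unit_not_cube_of_lucas hF2 (discr_eq_twentyFour hF2 hω) hp hp2 hp3 hJ24 (by norm_num) hLuc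
  -- the descent on `y² = x³ − 2p²`
  have hp0 : (p : ℚ) ≠ 0 := Nat.cast_ne_zero.mpr hp.ne_zero
  have hk0 : (-2 * (p : ℚ) ^ 2) ≠ 0 := mul_ne_zero (by norm_num) (pow_ne_zero 2 hp0)
  haveI := isElliptic_mordellCurve hk0
  have hrank := mordellWeilRank_sylvesterTwist_eq_zero hF2 hω cF hcF hK cK hcK hp hp9 hab h9 ⟨u₀, hu₀⟩
  have hsha := forall_mem_sha_three_nsmul_eq_zero hF2 hω cF hcF hK cK hcK hp hp9 hab h9 ⟨u₀, hu₀⟩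
  -- the door at `j = 0`
  have hj : (mordellCurve (-2 * (p : ℚ) ^ 2)).j = 0 := j_eq_zero _ (mordellCurve_c₄ _)
  obtain ⟨-, hL⟩ := L_one_ne_zero_of_desc_BT hBT (mordellCurve (-2 * (p : ℚ) ^ 2)) hj hrank hsha
  -- transport along `W_p^{(−8)} ≅ (y² = x³ − 2p²)`
  haveI : ((⟨0, 0, (p : ℚ), 0, 0⟩ : WeierstrassCurve ℚ).quadraticTwist (((-8 : ℤ)) : ℚ)).IsElliptic :=
    haveI := isElliptic_sylvester hp.ne_zero
    (⟨0, 0, (p : ℚ), 0, 0⟩ : WeierstrassCurve ℚ).isElliptic_quadraticTwist (by norm_num)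
  rw [← entireLFunction_smul _ (⟨Units.mk0 (2 : ℚ) two_ne_zero, 0, 0, 0⟩ : VariableChange ℚ), variableChange_twist]
  exact hL

/-! ## §3 The crux conclusion at `(W_p, p)` with `K′ = ℚ(√−2)` -/

/-- ★★★ **The Sylvester corner with `K′ = ℚ(√−2)` from the certificates, modulo Burungale–Tian ONLY.** For a prime `p ≡ 17, 35 (mod 72)`
with (h1) `X³ − 3X − 10` irreducible mod `p` and (h2) `p = a² + 2b²`, `9 ∤ a`: an imaginary quadratic `K′` (`= ℚ(√−2)`, `d_{K′} = −8`,
`h(K′) = 1`) with `4 < |d_{K′}|`, Heegner for `N(W_p)`, `L(W_p^{(d_{K′})}, 1) ≠ 0`, `h(K′) < p`, `p ∤ h(K′)` — the conclusion of crux 21381 at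
`(W_p, p)`. (g31's `cruxConclusion_sqrtMinusTwo` with `hDescU` DISCHARGED for this family by the twisted descent, at the price of (h2).)
[cite: CohenPazuki2009, §2] [cite: BurungaleTian2026, Thm. 1.1] [cite: IrelandRosen1990, §9.1] -/
theorem cruxConclusion_sqrtMinusTwo_of_certificates (hBT : burungaleTian_analyticRank_eq_zero_of_selmerCorank_eq_zero_of_hasCM)
    {p : ℕ} (hp : p.Prime) (hp72 : p % 72 = 17 ∨ p % 72 = 35) (h1 : ∀ x : ZMod p, x ^ 3 - 3 * x - 10 ≠ 0)
    (h2 : ∃ a b : ℤ, a ^ 2 + 2 * b ^ 2 = p ∧ ¬ (9 : ℤ) ∣ a) [(⟨0, 0, (p : ℚ), 0, 0⟩ : WeierstrassCurve ℚ).IsElliptic] :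
    ∃ (K : Type) (_ : Field K) (_ : NumberField K),
      IsImaginaryQuadratic K ∧ 4 < (NumberField.discr K).natAbs ∧
      SatisfiesHeegnerHypothesis ((⟨0, 0, (p : ℚ), 0, 0⟩ : WeierstrassCurve ℚ).conductorNorm ℤ) K ∧
      ((⟨0, 0, (p : ℚ), 0, 0⟩ : WeierstrassCurve ℚ).quadraticTwist (NumberField.discr K : ℚ)).entireLFunction 1 ≠ 0 ∧
      NumberField.classNumber K < p ∧ ¬ p ∣ NumberField.classNumber K := by
  obtain ⟨hp9, hp8⟩ := (mod_seventyTwo_iff p).mp hp72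
  have hp2 : p ≠ 2 := by rintro rfl; omega
  obtain ⟨a, b, hab, h9⟩ := h2
  have hL := entireLFunction_twist_one_ne_zero hBT hp hp72 h1 hab h9
  obtain ⟨K, iF, iN, hK, hdK, hhK⟩ : ∃ (K : Type) (_ : Field K) (_ : NumberField K),
      IsImaginaryQuadratic K ∧ NumberField.discr K = -8 ∧ NumberField.classNumber K = 1 :=
    exists_field_of_four_mul (-2) (by norm_num) 1 (by norm_num) (by norm_num) (by decide +kernel) (by decide +kernel)
  refine ⟨K, iF, iN, hK, by rw [hdK]; norm_num, ?_, by rw [hdK]; exact hL, by rw [hhK]; exact hp.one_lt,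
    by rw [hhK]; exact fun h => hp.one_lt.ne' (Nat.dvd_one.mp h)⟩
  exact satisfiesHeegnerHypothesis_of_three_p hK.1 hp2 (by rw [hdK]; exact jacobiSym_neg_eight_three)
    (by rw [hdK]; exact jacobiSym_neg_eight_eq_one hp8) (fun r hr hrN => eq_three_or_eq_of_prime_dvd_conductorNorm_W hp hr hrN)

/-- ★★★ **CLOSED form** (no instance binders): for every prime `p ≡ 17, 35 (mod 72)` with (h1) and (h2), the conclusion of
`HeegnerTwistCouplingInSupply` at `(W_p, p)` — MODULO Burungale–Tian ONLY. [cite: CohenPazuki2009, §2] [cite: BurungaleTian2026, Thm. 1.1] -/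
theorem cruxOnSylvesterCorner_of_certificates (hBT : burungaleTian_analyticRank_eq_zero_of_selmerCorank_eq_zero_of_hasCM) :
    ∀ (p : ℕ) (hp : p.Prime), (p % 72 = 17 ∨ p % 72 = 35) → (∀ x : ZMod p, x ^ 3 - 3 * x - 10 ≠ 0) →
      (∃ a b : ℤ, a ^ 2 + 2 * b ^ 2 = p ∧ ¬ (9 : ℤ) ∣ a) →
      haveI := isElliptic_sylvester hp.ne_zero
      ∃ (K : Type) (_ : Field K) (_ : NumberField K),
        IsImaginaryQuadratic K ∧ 4 < (NumberField.discr K).natAbs ∧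
        SatisfiesHeegnerHypothesis ((⟨0, 0, (p : ℚ), 0, 0⟩ : WeierstrassCurve ℚ).conductorNorm ℤ) K ∧
        ((⟨0, 0, (p : ℚ), 0, 0⟩ : WeierstrassCurve ℚ).quadraticTwist (NumberField.discr K : ℚ)).entireLFunction 1 ≠ 0 ∧
        NumberField.classNumber K < p ∧ ¬ p ∣ NumberField.classNumber K := by
  intro p hp hp72 h1 h2
  haveI := isElliptic_sylvester hp.ne_zero
  exact cruxConclusion_sqrtMinusTwo_of_certificates hBT hp hp72 h1 h2

/-- ★★★ **THE CRUX BODY ON `W := W_n`** for every prime `n ≡ 17, 35 (mod 72)` with (h1) and (h2) (shape of g31's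
`heegnerTwistCouplingInSupply_sylvester_sqrtMinusTwo`, `hDescU` removed): for every prime `p` and all the crux's hypotheses on
`(W_n, p)` (only `¬ Good` and `5 ≤ p` are used: `p = n`), a Heegner `K′` of `N(W_n)` with `4 < |d_{K′}|`, `L(W_n^{(d_{K′})}, 1) ≠ 0`,
`p ∤ h(K′)` — MODULO Burungale–Tian ONLY. [cite: CohenPazuki2009, §2] [cite: BurungaleTian2026, Thm. 1.1] -/
theorem heegnerTwistCouplingInSupply_sylvester_of_certificates
    (hBT : burungaleTian_analyticRank_eq_zero_of_selmerCorank_eq_zero_of_hasCM) {n : ℕ} (hn : n.Prime)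
    (hn72 : n % 72 = 17 ∨ n % 72 = 35) (h1 : ∀ x : ZMod n, x ^ 3 - 3 * x - 10 ≠ 0)
    (h2 : ∃ a b : ℤ, a ^ 2 + 2 * b ^ 2 = n ∧ ¬ (9 : ℤ) ∣ a) :
    ∀ (p : ℕ) [Fact p.Prime] [(⟨0, 0, (n : ℚ), 0, 0⟩ : WeierstrassCurve ℚ).IsElliptic]
      [(⟨0, 0, (n : ℚ), 0, 0⟩ : WeierstrassCurve ℚ).IsGloballyMinimal]
      [NeZero ((⟨0, 0, (n : ℚ), 0, 0⟩ : WeierstrassCurve ℚ).conductorNorm ℤ)],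
      (⟨0, 0, (n : ℚ), 0, 0⟩ : WeierstrassCurve ℚ).HasCM → (⟨0, 0, (n : ℚ), 0, 0⟩ : WeierstrassCurve ℚ).analyticRank = 1 → 5 ≤ p →
      CMInert (⟨0, 0, (n : ℚ), 0, 0⟩ : WeierstrassCurve ℚ) p → ¬ Good (⟨0, 0, (n : ℚ), 0, 0⟩ : WeierstrassCurve ℚ) p →
      (∀ B : ℕ, ∃ (K : Type) (_ : Field K) (_ : NumberField K), IsImaginaryQuadratic K ∧ B < (NumberField.discr K).natAbs ∧
        4 < (NumberField.discr K).natAbs ∧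
        SatisfiesHeegnerHypothesis ((⟨0, 0, (n : ℚ), 0, 0⟩ : WeierstrassCurve ℚ).conductorNorm ℤ) K ∧
        ¬ p ∣ NumberField.classNumber K) →
      ∃ (K : Type) (_ : Field K) (_ : NumberField K),
        IsImaginaryQuadratic K ∧ 4 < (NumberField.discr K).natAbs ∧
        SatisfiesHeegnerHypothesis ((⟨0, 0, (n : ℚ), 0, 0⟩ : WeierstrassCurve ℚ).conductorNorm ℤ) K ∧
        ((⟨0, 0, (n : ℚ), 0, 0⟩ : WeierstrassCurve ℚ).quadraticTwist (NumberField.discr K : ℚ)).entireLFunction 1 ≠ 0 ∧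
        ¬ p ∣ NumberField.classNumber K := by
  intro p _ _ _ _ _ _ h5 _ hbad _
  obtain rfl := eq_of_not_good_sylvester hn h5 hbad
  obtain ⟨K, iF, iN, hK, h4, hH, hL, -, hndvd⟩ := cruxConclusion_sqrtMinusTwo_of_certificates hBT hn hn72 h1 h2
  exact ⟨K, iF, iN, hK, h4, hH, hL, hndvd⟩

/-! ## §4 Kernel instances -/

/-- ★ **`p = 17`** (`17 ≡ 17 (mod 72)`, `X³ − 3X − 10` irreducible mod `17`, `17 = 3² + 2·2²`, `9 ∤ 3`): the conclusion of crux 21381 at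
`(W_17, 17)` with `K′ = ℚ(√−2)`, modulo Burungale–Tian ONLY. [cite: CohenPazuki2009, §2] [cite: BurungaleTian2026, Thm. 1.1] -/
theorem cruxOnSylvesterCorner_of_certificates_17 (hBT : burungaleTian_analyticRank_eq_zero_of_selmerCorank_eq_zero_of_hasCM) :
    haveI := isElliptic_sylvester (show (17 : ℕ) ≠ 0 by norm_num)
    ∃ (K : Type) (_ : Field K) (_ : NumberField K),
      IsImaginaryQuadratic K ∧ 4 < (NumberField.discr K).natAbs ∧
      SatisfiesHeegnerHypothesis ((⟨0, 0, ((17 : ℕ) : ℚ), 0, 0⟩ : WeierstrassCurve ℚ).conductorNorm ℤ) K ∧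
      ((⟨0, 0, ((17 : ℕ) : ℚ), 0, 0⟩ : WeierstrassCurve ℚ).quadraticTwist (NumberField.discr K : ℚ)).entireLFunction 1 ≠ 0 ∧
      NumberField.classNumber K < 17 ∧ ¬ 17 ∣ NumberField.classNumber K :=
  cruxOnSylvesterCorner_of_certificates hBT 17 (by norm_num) (by norm_num) noRoot_17 ⟨3, 2, by norm_num, by decide⟩

/-- ★ **`p = 107`** (`107 ≡ 35 (mod 72)`, `X³ − 3X − 10` irreducible mod `107`, `107 = 3² + 2·7²`, `9 ∤ 3`): the conclusion of crux 21381 at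
`(W_107, 107)` with `K′ = ℚ(√−2)`, modulo Burungale–Tian ONLY. [cite: CohenPazuki2009, §2] [cite: BurungaleTian2026, Thm. 1.1] -/
theorem cruxOnSylvesterCorner_of_certificates_107 (hBT : burungaleTian_analyticRank_eq_zero_of_selmerCorank_eq_zero_of_hasCM) :
    haveI := isElliptic_sylvester (show (107 : ℕ) ≠ 0 by norm_num)
    ∃ (K : Type) (_ : Field K) (_ : NumberField K),
      IsImaginaryQuadratic K ∧ 4 < (NumberField.discr K).natAbs ∧
      SatisfiesHeegnerHypothesis ((⟨0, 0, ((107 : ℕ) : ℚ), 0, 0⟩ : WeierstrassCurve ℚ).conductorNorm ℤ) K ∧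
      ((⟨0, 0, ((107 : ℕ) : ℚ), 0, 0⟩ : WeierstrassCurve ℚ).quadraticTwist (NumberField.discr K : ℚ)).entireLFunction 1 ≠ 0 ∧
      NumberField.classNumber K < 107 ∧ ¬ 107 ∣ NumberField.classNumber K :=
  cruxOnSylvesterCorner_of_certificates hBT 107 (by norm_num) (by norm_num) noRoot_107 ⟨3, 7, by norm_num, by decide⟩

end Summit.BirchSwinnertonDyer.BirchSwinnertonDyer.Theorems.SylvesterTwistDescent

end
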